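import Summits.QuantumFields.YangMills.Theorems.ColdStartUniversalityLatticeLangevinSU2Bracket
import Summits.QuantumFields.YangMills.Theorems.ColdStartUniversalityLatticeLangevinGradientDriftFlat
import Mathlib.Topology.Algebra.Module.FiniteDimension
import HarnessLib

/-!
# Route `ColdStartUniversality` (fixed-cut-off package, Bakry–Émery side): the NOISE FRAME of the SU(2) lattice Langevin dynamics in the
# real link coordinates — linear vector fields closing under brackets, antisymmetric structure tensor, Ricci identity, Casimir sum

Helper file (seat `ym-line-csu-p1`, g25; `--supports stmt-QuantumFields-24809`).  In the real link coordinates `y ∈ ℝ^(E×2×2×2)` of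
`dynkin_expectation_szz` the noise coefficient of the SZZ system for the index `n = (e, ν)` is the vector
`σ_n(y) = coords of δ_e (√2·𝐩(E_ν)·Q_e)`, `Q = rebuild y` — a LINEAR vector field on the flat coordinate space.  ★★ `exists_noiseFrame`
packages the five facts the Bochner computation needs (hypotheses of `…FrameCalculus` / `…FrameBochner`):
(1) each `σ_n` is a continuous linear map `s n`; (2) BRACKETS: `s_m(s_n y) − s_n(s_m y) = Σ_k c_(nmk) s_k y` with
`c_(nmk) = [e_n = e_m = e_k] ⟨2[P_μ,P_ν], P_κ⟩/√2` (closure of `𝔰𝔲(2)` + Parseval); (3) `c_(nmk) = −c_(nkm)`; (4) the RICCI IDENTITY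
`¼ Σ_(n,m) Λ(s_m s_n y − s_n s_m y)² = 2 Σ_n Λ(s_n y)²` for every linear functional `Λ` (curvature `2` of `Σ_n W_n²`, i.e. `Ric = N/2 = 1`
for the SZZ generator `½Σ W_n²`, Shen–Zhu–Zhu (4.8)); (5) `Σ_n s_n(s_n y) = coords of 2·C_𝔤·Q` (the Itô–Stratonovich / Casimir drift).
All computations are done at the level of rebuilt matrices (`rebuild` is injective and linear), never entrywise.
THEOREMS ONLY, no definition, no sorry.  HONEST FRAMING: finite-dimensional linear algebra at fixed cut-off; nothing K-uniform; no
statement about the Yang–Mills mass gap.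
-/

set_option autoImplicit false

noncomputable section

namespace Summit.QuantumFields.YangMills.Theorems.ColdStartUniversality

open Matrix Complex Finset
open scoped ComplexConjugate BigOperators Matrix
open Literature.MathematicalPhysics.QuantumFieldTheory
open Literature.MathematicalPhysics.QuantumLattice (fundamentalRep fundamentalLatticeRep)

variable {L : ℕ} [NeZero L]

/-! ## §1. `rebuild` (coordinates → matrices) is linear and injective; `flat ∘ rebuild = id` -/

omit [NeZero L] in
/-- `rebuild` is additive. [folklore] -/
theorem rebuild_add (y y' : (Edge 3 L × Fin (fundamentalLatticeRep 2).N × Fin (fundamentalLatticeRep 2).N × Bool → ℝ)) :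
    (fun (e : Edge 3 L) => Matrix.of fun (i j : Fin (fundamentalLatticeRep 2).N) => (((y + y') (e, i, j, false) : ℝ) : ℂ) + (((y + y') (e, i, j, true) : ℝ) : ℂ) * Complex.I) = (fun (e : Edge 3 L) => Matrix.of fun (i j : Fin (fundamentalLatticeRep 2).N) => ((y (e, i, j, false) : ℝ) : ℂ) + ((y (e, i, j, true) : ℝ) : ℂ) * Complex.I) + (fun (e : Edge 3 L) => Matrix.of fun (i j : Fin (fundamentalLatticeRep 2).N) => ((y' (e, i, j, false) : ℝ) : ℂ) + ((y' (e, i, j, true) : ℝ) : ℂ) * Complex.I) := by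
  funext e
  ext i j
  simp only [Pi.add_apply, Matrix.add_apply, Matrix.of_apply]
  push_cast
  ring

omit [NeZero L] in
/-- `rebuild` commutes with real scalars. [folklore] -/
theorem rebuild_smul (a : ℝ) (y : (Edge 3 L × Fin (fundamentalLatticeRep 2).N × Fin (fundamentalLatticeRep 2).N × Bool → ℝ)) :
    (fun (e : Edge 3 L) => Matrix.of fun (i j : Fin (fundamentalLatticeRep 2).N) => (((a • y) (e, i, j, false) : ℝ) : ℂ) + (((a • y) (e, i, j, true) : ℝ) : ℂ) * Complex.I) = (a : ℂ) • (fun (e : Edge 3 L) => Matrix.of fun (i j : Fin (fundamentalLatticeRep 2).N) => ((y (e, i, j, false) : ℝ) : ℂ) + ((y (e, i, j, true) : ℝ) : ℂ) * Complex.I) := by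
  funext e
  ext i j
  simp only [Pi.smul_apply, smul_eq_mul, Matrix.smul_apply, Matrix.of_apply]
  push_cast
  ring

omit [NeZero L] in
/-- `rebuild` of a finite sum. [folklore] -/
theorem rebuild_sum {ι : Type*} (S : Finset ι) (f : ι → (Edge 3 L × Fin (fundamentalLatticeRep 2).N × Fin (fundamentalLatticeRep 2).N × Bool → ℝ)) :
    (fun (e : Edge 3 L) => Matrix.of fun (i j : Fin (fundamentalLatticeRep 2).N) => (((∑ k ∈ S, f k) (e, i, j, false) : ℝ) : ℂ) + (((∑ k ∈ S, f k) (e, i, j, true) : ℝ) : ℂ) * Complex.I) = ∑ k ∈ S, (fun (e : Edge 3 L) => Matrix.of fun (i j : Fin (fundamentalLatticeRep 2).N) => (((f k) (e, i, j, false) : ℝ) : ℂ) + (((f k) (e, i, j, true) : ℝ) : ℂ) * Complex.I) := by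
  classical
  induction S using Finset.induction_on with
  | empty =>
    rw [Finset.sum_empty, Finset.sum_empty]
    funext e; ext i j
    simp only [Pi.zero_apply, Matrix.zero_apply, Matrix.of_apply]
    push_cast
    ring
  | insert a S ha ih =>
    rw [Finset.sum_insert ha, Finset.sum_insert ha, rebuild_add, ih]

omit [NeZero L] in
/-- **`rebuild` is injective**: a coordinate vector is determined by its rebuilt matrices. [folklore] -/
theorem eq_of_rebuild_eq {v w : (Edge 3 L × Fin (fundamentalLatticeRep 2).N × Fin (fundamentalLatticeRep 2).N × Bool → ℝ)}
    (h : (fun (e : Edge 3 L) => Matrix.of fun (i j : Fin (fundamentalLatticeRep 2).N) => ((v (e, i, j, false) : ℝ) : ℂ) + ((v (e, i, j, true) : ℝ) : ℂ) * Complex.I) = (fun (e : Edge 3 L) => Matrix.of fun (i j : Fin (fundamentalLatticeRep 2).N) => ((w (e, i, j, false) : ℝ) : ℂ) + ((w (e, i, j, true) : ℝ) : ℂ) * Complex.I)) : v = w := by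
  funext q
  obtain ⟨e, i, j, b⟩ := q
  have h1 := congrFun (congrFun (congrFun h e) i) j
  simp only [Matrix.of_apply] at h1
  have hre := congrArg Complex.re h1
  have him := congrArg Complex.im h1
  simp at hre him
  cases b
  · exact hre
  · exact him

omit [NeZero L] in
/-- **`rebuild ∘ flat = id`** on matrix configurations (`Re z + (Im z)·i = z`). [folklore] -/
theorem rebuild_flat_of (M : (Edge 3 L → Matrix (Fin (fundamentalLatticeRep 2).N) (Fin (fundamentalLatticeRep 2).N) ℂ)) :
    (fun (e : Edge 3 L) => Matrix.of fun (i j : Fin (fundamentalLatticeRep 2).N) => (((fun q : Edge 3 L × Fin (fundamentalLatticeRep 2).N × Fin (fundamentalLatticeRep 2).N × Bool => (fun z : ℂ => if q.2.2.2 then z.im else z.re) (M q.1 q.2.1 q.2.2.1)) (e, i, j, false) : ℝ) : ℂ) + (((fun q : Edge 3 L × Fin (fundamentalLatticeRep 2).N × Fin (fundamentalLatticeRep 2).N × Bool => (fun z : ℂ => if q.2.2.2 then z.im else z.re) (M q.1 q.2.1 q.2.2.1)) (e, i, j, true) : ℝ) : ℂ) * Complex.I) = M := by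
  funext e
  ext i j
  simp only [Matrix.of_apply, Bool.false_eq_true, if_false, if_true]
  exact Complex.re_add_im _

omit [NeZero L] in
/-- **`rebuild` of the noise field**: `rebuild(σ_n(y)) = δ_e(√2 P_ν Q_e)`. [folklore] -/
theorem rebuild_noise (n : Edge 3 L × NoiseIdx (fundamentalLatticeRep 2).N) (y : (Edge 3 L × Fin (fundamentalLatticeRep 2).N × Fin (fundamentalLatticeRep 2).N × Bool → ℝ)) :
    (fun (e : Edge 3 L) => Matrix.of fun (i j : Fin (fundamentalLatticeRep 2).N) => (((fun q : Edge 3 L × Fin (fundamentalLatticeRep 2).N × Fin (fundamentalLatticeRep 2).N × Bool => if n.1 = q.1 then (fun z : ℂ => if q.2.2.2 then z.im else z.re) (((Real.sqrt 2 : ℂ) • ((fundamentalLatticeRep 2).lieProj (noiseDir n.2) * (fun (e : Edge 3 L) => Matrix.of fun (i j : Fin (fundamentalLatticeRep 2).N) => ((y (e, i, j, false) : ℝ) : ℂ) + ((y (e, i, j, true) : ℝ) : ℂ) * Complex.I) q.1)) q.2.1 q.2.2.1) else 0) (e, i, j, false) : ℝ) : ℂ) + (((fun q : Edge 3 L ×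 Fin (fundamentalLatticeRep 2).N × Fin (fundamentalLatticeRep 2).N × Bool => if n.1 = q.1 then (fun z : ℂ => if q.2.2.2 then z.im else z.re) (((Real.sqrt 2 : ℂ) • ((fundamentalLatticeRep 2).lieProj (noiseDir n.2) * (fun (e : Edge 3 L) => Matrix.of fun (i j : Fin (fundamentalLatticeRep 2).N) => ((y (e, i, j, false) : ℝ) : ℂ) + ((y (e, i, j, true) : ℝ) : ℂ) * Complex.I) q.1)) q.2.1 q.2.2.1) else 0) (e, i, j, true) : ℝ) : ℂ) * Complex.I) =
      fun e => if n.1 = e then (Real.sqrt 2 : ℂ) • ((fundamentalLatticeRep 2).lieProj (noiseDir n.2) * (fun (e : Edge 3 L) => Matrix.of fun (i j : Fin (fundamentalLatticeRep 2).N) => ((y (e, i, j, false) : ℝ) : ℂ) + ((y (e, i, j, true) : ℝ) : ℂ) * Complex.I) e) else 0 := by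
  funext e
  ext i j
  by_cases h : n.1 = e
  · simp only [Matrix.of_apply, h, if_true, Bool.false_eq_true, if_false]
    exact Complex.re_add_im _
  · simp only [Matrix.of_apply, h, if_false, Matrix.zero_apply]
    push_cast
    ring

/-! ## §2. The noise frame package -/

/-- ★★ **The noise frame of the SU(2) SZZ dynamics in flat coordinates.**  There are continuous linear maps `s n` (`n ∈ E × NoiseIdx`)
equal to the noise fields `y ↦ coords δ_e(√2·𝐩(E_ν)·(rebuild y)_e)`, and a structure tensor `c`, antisymmetric in its last two slots,
with (bracket) `s_m(s_n y) − s_n(s_m y) = Σ_k c_(nmk) s_k y`, (Ricci) `¼ Σ_(n,m) Λ(s_m s_n y − s_n s_m y)² = 2 Σ_n Λ(s_n y)²` for every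
continuous linear functional `Λ`, and (Casimir) `Σ_n s_n(s_n y) = coords(2·C_𝔤·rebuild y)`. [folklore] -/
theorem exists_noiseFrame (L : ℕ) [NeZero L] :
    ∃ (s : (Edge 3 L × NoiseIdx (fundamentalLatticeRep 2).N) → ((Edge 3 L × Fin (fundamentalLatticeRep 2).N × Fin (fundamentalLatticeRep 2).N × Bool → ℝ) →L[ℝ] (Edge 3 L × Fin (fundamentalLatticeRep 2).N × Fin (fundamentalLatticeRep 2).N × Bool → ℝ)))
      (c : (Edge 3 L × NoiseIdx (fundamentalLatticeRep 2).N) → (Edge 3 L × NoiseIdx (fundamentalLatticeRep 2).N) → (Edge 3 L × NoiseIdx (fundamentalLatticeRep 2).N) → ℝ),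
      (∀ (n : Edge 3 L × NoiseIdx (fundamentalLatticeRep 2).N) (y : (Edge 3 L × Fin (fundamentalLatticeRep 2).N × Fin (fundamentalLatticeRep 2).N × Bool → ℝ)), s n y = (fun q : Edge 3 L × Fin (fundamentalLatticeRep 2).N × Fin (fundamentalLatticeRep 2).N × Bool => if n.1 = q.1 then (fun z : ℂ => if q.2.2.2 then z.im else z.re) (((Real.sqrt 2 : ℂ) • ((fundamentalLatticeRep 2).lieProj (noiseDir n.2) * (fun (e : Edge 3 L) => Matrix.of fun (i j : Fin (fundamentalLatticeRep 2).N) => ((y (e, i, j, false) : ℝ) : ℂ) + ((y (e, i, j, true) : ℝ) : ℂ) * Complex.I) q.1)) q.2.1 q.2.2.1) else 0)) ∧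
      (∀ (n m : Edge 3 L × NoiseIdx (fundamentalLatticeRep 2).N) (y : (Edge 3 L × Fin (fundamentalLatticeRep 2).N × Fin (fundamentalLatticeRep 2).N × Bool → ℝ)), s m (s n y) - s n (s m y) = ∑ k, c n m k • s k y) ∧
      (∀ n m k : Edge 3 L × NoiseIdx (fundamentalLatticeRep 2).N, c n m k = -c n k m) ∧
      (∀ (Λ : (Edge 3 L × Fin (fundamentalLatticeRep 2).N × Fin (fundamentalLatticeRep 2).N × Bool → ℝ) →L[ℝ] ℝ) (y : (Edge 3 L × Fin (fundamentalLatticeRep 2).N × Fin (fundamentalLatticeRep 2).N × Bool → ℝ)),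
        (1 / 4 : ℝ) * ∑ n, ∑ m, (Λ (s m (s n y) - s n (s m y))) ^ 2 = 2 * ∑ n, (Λ (s n y)) ^ 2) ∧
      (∀ (y : (Edge 3 L × Fin (fundamentalLatticeRep 2).N × Fin (fundamentalLatticeRep 2).N × Bool → ℝ)), ∑ n, s n (s n y) =
        (fun q : Edge 3 L × Fin (fundamentalLatticeRep 2).N × Fin (fundamentalLatticeRep 2).N × Bool => (fun z : ℂ => if q.2.2.2 then z.im else z.re) ((fun e => ((2 : ℝ) : ℂ) • ((fundamentalLatticeRep 2).casimir * (fun (e : Edge 3 L) => Matrix.of fun (i j : Fin (fundamentalLatticeRep 2).N) => ((y (e, i, j, false) : ℝ) : ℂ) + ((y (e, i, j, true) : ℝ) : ℂ) * Complex.I) e)) q.1 q.2.1 q.2.2.1))) := by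
  classical
  -- abbreviations
  set P : NoiseIdx (fundamentalLatticeRep 2).N → Matrix (Fin (fundamentalLatticeRep 2).N) (Fin (fundamentalLatticeRep 2).N) ℂ := fun ν => (fundamentalLatticeRep 2).lieProj (noiseDir ν) with hP
  set reb : (Edge 3 L × Fin (fundamentalLatticeRep 2).N × Fin (fundamentalLatticeRep 2).N × Bool → ℝ) → (Edge 3 L → Matrix (Fin (fundamentalLatticeRep 2).N) (Fin (fundamentalLatticeRep 2).N) ℂ) := fun y => (fun (e : Edge 3 L) => Matrix.of fun (i j : Fin (fundamentalLatticeRep 2).N) => ((y (e, i, j, false) : ℝ) : ℂ) + ((y (e, i, j, true) : ℝ) : ℂ) * Complex.I) with hreb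
  set flat : (Edge 3 L → Matrix (Fin (fundamentalLatticeRep 2).N) (Fin (fundamentalLatticeRep 2).N) ℂ) → (Edge 3 L × Fin (fundamentalLatticeRep 2).N × Fin (fundamentalLatticeRep 2).N × Bool → ℝ) := fun M => (fun q : Edge 3 L × Fin (fundamentalLatticeRep 2).N × Fin (fundamentalLatticeRep 2).N × Bool => (fun z : ℂ => if q.2.2.2 then z.im else z.re) (M q.1 q.2.1 q.2.2.1)) with hflat
  set σ : (Edge 3 L × NoiseIdx (fundamentalLatticeRep 2).N) → (Edge 3 L × Fin (fundamentalLatticeRep 2).N × Fin (fundamentalLatticeRep 2).N × Bool → ℝ) → (Edge 3 L × Fin (fundamentalLatticeRep 2).N × Fin (fundamentalLatticeRep 2).N × Bool → ℝ) := fun n y => (fun q : Edge 3 L × Fin (fundamentalLatticeRep 2).N × Fin (fundamentalLatticeRep 2).N × Bool => if n.1 = q.1 then (fun z : ℂ => if q.2.2.2 then z.im else z.re) (((Real.sqrt 2 : ℂ) • ((fundamentalLatticeRep 2).lieProj (noiseDir n.2) * (fun (e : Edge 3 L) => Matrix.of fun (i j : Fin (fundamentalLatticeRep 2).N) => ((y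 (e, i, j, false) : ℝ) : ℂ) + ((y (e, i, j, true) : ℝ) : ℂ) * Complex.I) q.1)) q.2.1 q.2.2.1) else 0) with hσ
  -- §1 facts in the abbreviations
  have r_add : ∀ v w : (Edge 3 L × Fin (fundamentalLatticeRep 2).N × Fin (fundamentalLatticeRep 2).N × Bool → ℝ), reb (v + w) = reb v + reb w := fun v w => rebuild_add v w
  have r_smul : ∀ (a : ℝ) (v : (Edge 3 L × Fin (fundamentalLatticeRep 2).N × Fin (fundamentalLatticeRep 2).N × Bool → ℝ)), reb (a • v) = (a : ℂ) • reb v := fun a v => rebuild_smul a v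
  have r_sum : ∀ (f : (Edge 3 L × NoiseIdx (fundamentalLatticeRep 2).N) → (Edge 3 L × Fin (fundamentalLatticeRep 2).N × Fin (fundamentalLatticeRep 2).N × Bool → ℝ)), reb (∑ k, f k) = ∑ k, reb (f k) :=
    fun f => rebuild_sum Finset.univ f
  have r_inj : ∀ v w : (Edge 3 L × Fin (fundamentalLatticeRep 2).N × Fin (fundamentalLatticeRep 2).N × Bool → ℝ), reb v = reb w → v = w := fun v w h => eq_of_rebuild_eq h
  have r_flat : ∀ M : (Edge 3 L → Matrix (Fin (fundamentalLatticeRep 2).N) (Fin (fundamentalLatticeRep 2).N) ℂ), reb (flat M) = M := fun M => rebuild_flat_of M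
  have r_σ : ∀ n y, reb (σ n y) = fun e => if n.1 = e then (Real.sqrt 2 : ℂ) • (P n.2 * reb y e) else 0 :=
    fun n y => rebuild_noise n y
  have r_sub : ∀ v w : (Edge 3 L × Fin (fundamentalLatticeRep 2).N × Fin (fundamentalLatticeRep 2).N × Bool → ℝ), reb (v - w) = reb v - reb w := by
    intro v w
    have h := r_add (v - w) w
    rw [sub_add_cancel] at h
    exact eq_sub_of_add_eq h.symm
  have flat_reb : ∀ v : (Edge 3 L × Fin (fundamentalLatticeRep 2).N × Fin (fundamentalLatticeRep 2).N × Bool → ℝ), flat (reb v) = v := fun v => r_inj _ _ (r_flat _)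
  have hsqrt : (Real.sqrt 2 : ℂ) * (Real.sqrt 2 : ℂ) = 2 := by
    rw [← Complex.ofReal_mul, Real.mul_self_sqrt (by norm_num : (0:ℝ) ≤ 2)]; norm_num
  -- (1) linearity, via injectivity of `rebuild`
  have hadd : ∀ n y y', σ n (y + y') = σ n y + σ n y' := by
    intro n y y'
    refine r_inj _ _ ?_
    rw [r_add, r_σ, r_σ, r_σ, r_add]
    funext e
    simp only [Pi.add_apply]
    split_ifs
    · rw [Matrix.mul_add, smul_add]
    · rw [add_zero]
  have hsmul : ∀ n (a : ℝ) y, σ n (a • y) = a • σ n y := by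
    intro n a y
    refine r_inj _ _ ?_
    rw [r_smul, r_σ, r_σ, r_smul]
    funext e
    simp only [Pi.smul_apply]
    split_ifs
    · rw [Matrix.mul_smul, smul_comm]
    · rw [smul_zero]
  have hlin : ∀ n, ∃ T : (Edge 3 L × Fin (fundamentalLatticeRep 2).N × Fin (fundamentalLatticeRep 2).N × Bool → ℝ) →L[ℝ] (Edge 3 L × Fin (fundamentalLatticeRep 2).N × Fin (fundamentalLatticeRep 2).N × Bool → ℝ), ∀ y, T y = σ n y := by
    intro n
    let Tl : (Edge 3 L × Fin (fundamentalLatticeRep 2).N × Fin (fundamentalLatticeRep 2).N × Bool → ℝ) →ₗ[ℝ] (Edge 3 L × Fin (fundamentalLatticeRep 2).N × Fin (fundamentalLatticeRep 2).N × Bool → ℝ) :=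
      { toFun := σ n, map_add' := hadd n, map_smul' := fun a y => hsmul n a y }
    exact ⟨LinearMap.toContinuousLinearMap Tl, fun y => rfl⟩
  choose s hs using hlin
  -- (2) the iterates and brackets, at the level of rebuilt matrices
  have r_σσ : ∀ n m y, reb (σ m (σ n y)) = fun e => if m.1 = e ∧ n.1 = e then
      ((2 : ℝ) : ℂ) • (P m.2 * P n.2 * reb y e) else 0 := by
    intro n m y
    rw [r_σ, r_σ]
    funext e
    dsimp only
    by_cases hm : m.1 = e
    · by_cases hn : n.1 = e
      · rw [if_pos hm, if_pos hn, if_pos ⟨hm, hn⟩, Matrix.mul_smul, smul_smul, hsqrt, ← Matrix.mul_assoc]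
        push_cast; rfl
      · rw [if_pos hm, if_neg hn, if_neg (fun h => hn h.2), Matrix.mul_zero, smul_zero]
    · rw [if_neg hm, if_neg (fun h => hm h.1)]
  set c : (Edge 3 L × NoiseIdx (fundamentalLatticeRep 2).N) → (Edge 3 L × NoiseIdx (fundamentalLatticeRep 2).N) → (Edge 3 L × NoiseIdx (fundamentalLatticeRep 2).N) → ℝ := fun n m k =>
    if n.1 = k.1 ∧ m.1 = k.1 then hsForm (fundamentalLatticeRep 2).N (((2 : ℝ) : ℂ) • (P m.2 * P n.2 - P n.2 * P m.2)) (P k.2) / Real.sqrt 2 else 0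
    with hc
  have hbr_mem : ∀ μ ν : NoiseIdx (fundamentalLatticeRep 2).N, ((2 : ℝ) : ℂ) • (P μ * P ν - P ν * P μ) ∈ (fundamentalLatticeRep 2).lieAlg := fun μ ν =>
    Submodule.smul_mem _ _ (bracket_lieProj_mem_lieAlg μ ν)
  have hParseval : ∀ X : Matrix (Fin (fundamentalLatticeRep 2).N) (Fin (fundamentalLatticeRep 2).N) ℂ, X ∈ (fundamentalLatticeRep 2).lieAlg →
      ∑ κ : NoiseIdx (fundamentalLatticeRep 2).N, hsForm (fundamentalLatticeRep 2).N X (P κ) • P κ = X := fun X hX => sum_hsForm_smul_lieProj_of_mem hX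
  have r_bracket : ∀ n m y, reb (σ m (σ n y) - σ n (σ m y)) = fun e => if n.1 = e ∧ m.1 = e then
      (((2 : ℝ) : ℂ) • (P m.2 * P n.2 - P n.2 * P m.2)) * reb y e else 0 := by
    intro n m y
    rw [r_sub, r_σσ, r_σσ]
    funext e
    rw [Pi.sub_apply]
    by_cases hn : n.1 = e
    · by_cases hm : m.1 = e
      · rw [if_pos ⟨hm, hn⟩, if_pos ⟨hn, hm⟩, if_pos ⟨hn, hm⟩, Matrix.smul_mul, Matrix.sub_mul, smul_sub]
      · rw [if_neg (fun h => hm h.1), if_neg (fun h => hm h.2), if_neg (fun h => hm h.2), sub_zero]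
    · rw [if_neg (fun h => hn h.2), if_neg (fun h => hn h.1), if_neg (fun h => hn h.1), sub_zero]
  have r_csum : ∀ n m y, reb (∑ k, c n m k • σ k y) = fun e => if n.1 = e ∧ m.1 = e then
      (((2 : ℝ) : ℂ) • (P m.2 * P n.2 - P n.2 * P m.2)) * reb y e else 0 := by
    intro n m y
    rw [r_sum]
    funext e
    rw [Finset.sum_apply]
    simp_rw [r_smul, r_σ]
    rw [Fintype.sum_prod_type, Finset.sum_eq_single e]
    · simp only [Pi.smul_apply, if_true]
      by_cases hnm : n.1 = e ∧ m.1 = e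
      · rw [if_pos hnm]
        have hterm : ∀ κ : NoiseIdx (fundamentalLatticeRep 2).N, ((c n m (e, κ) : ℝ) : ℂ) • ((Real.sqrt 2 : ℂ) • (P κ * reb y e)) =
            (hsForm (fundamentalLatticeRep 2).N (((2 : ℝ) : ℂ) • (P m.2 * P n.2 - P n.2 * P m.2)) (P κ) • P κ) * reb y e := by
          intro κ
          simp only [hc, hnm, and_self, if_true]
          rw [smul_smul, ← Complex.ofReal_mul, div_mul_cancel₀ _ (Real.sqrt_ne_zero'.2 (by norm_num : (0:ℝ) < 2)),
            Matrix.smul_mul, Complex.coe_smul]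
        simp_rw [hterm]
        rw [← Finset.sum_mul, hParseval _ (hbr_mem m.2 n.2)]
      · rw [if_neg hnm]
        refine Finset.sum_eq_zero fun κ _ => ?_
        simp only [hc, hnm, if_false, Complex.ofReal_zero, zero_smul]
    · intro e' _ he'
      refine Finset.sum_eq_zero fun κ _ => ?_
      rw [Pi.smul_apply, if_neg he', smul_zero]
    · intro h; exact absurd (Finset.mem_univ _) h
  have hbracket : ∀ n m y, s m (s n y) - s n (s m y) = ∑ k, c n m k • s k y := by
    intro n m y
    have h1 : s m (s n y) - s n (s m y) = σ m (σ n y) - σ n (σ m y) := by rw [hs n y, hs m, hs m y, hs n]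
    have h2 : ∑ k, c n m k • s k y = ∑ k, c n m k • σ k y := Finset.sum_congr rfl fun k _ => by rw [hs k y]
    rw [h1, h2]
    exact r_inj _ _ ((r_bracket n m y).trans (r_csum n m y).symm)
  -- (3) antisymmetry
  have hanti : ∀ n m k, c n m k = -c n k m := by
    intro n m k
    simp only [hc]
    by_cases h1 : n.1 = k.1 ∧ m.1 = k.1
    · have h2 : n.1 = m.1 ∧ k.1 = m.1 := ⟨h1.1.trans h1.2.symm, h1.2.symm⟩
      rw [if_pos h1, if_pos h2, hsForm_coe_smul_left, hsForm_coe_smul_left]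
      have hA : (P m.2)ᴴ = -P m.2 := by rw [← Matrix.star_eq_conjTranspose]; exact (fundamentalLatticeRep 2).star_lieProj _
      have hC : (P k.2)ᴴ = -P k.2 := by rw [← Matrix.star_eq_conjTranspose]; exact (fundamentalLatticeRep 2).star_lieProj _
      rw [hsForm_bracket_antisymm hA hC]
      ring
    · rw [if_neg h1]
      by_cases h2 : n.1 = m.1 ∧ k.1 = m.1
      · exact absurd ⟨h2.1.trans h2.2.symm, h2.2.symm⟩ h1
      · rw [if_neg h2, neg_zero]
  -- (4) Ricci identity
  have flat_add : ∀ A B : (Edge 3 L → Matrix (Fin (fundamentalLatticeRep 2).N) (Fin (fundamentalLatticeRep 2).N) ℂ), flat (A + B) = flat A + flat B := by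
    intro A B
    refine r_inj _ _ ?_
    rw [r_add, r_flat, r_flat, r_flat]
  have flat_smul : ∀ (a : ℝ) (A : (Edge 3 L → Matrix (Fin (fundamentalLatticeRep 2).N) (Fin (fundamentalLatticeRep 2).N) ℂ)), flat ((a : ℂ) • A) = a • flat A := by
    intro a A
    refine r_inj _ _ ?_
    rw [r_smul, r_flat, r_flat]
  have flat_zero : flat 0 = 0 := by
    refine r_inj _ _ ?_
    rw [r_flat]
    have h := r_add 0 0
    rw [add_zero] at h
    exact (left_eq_add.1 h).symm
  have hRic : ∀ (Λ : (Edge 3 L × Fin (fundamentalLatticeRep 2).N × Fin (fundamentalLatticeRep 2).N × Bool → ℝ) →L[ℝ] ℝ) (y : (Edge 3 L × Fin (fundamentalLatticeRep 2).N × Fin (fundamentalLatticeRep 2).N × Bool → ℝ)),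
      (1 / 4 : ℝ) * ∑ n, ∑ m, (Λ (s m (s n y) - s n (s m y))) ^ 2 = 2 * ∑ n, (Λ (s n y)) ^ 2 := by
    intro Λ y
    -- the per-edge functionals `ℓ_e(M) = Λ(flat δ_e(M Q_e))`
    have hblk : ∀ e : Edge 3 L, ∃ ℓ : Matrix (Fin (fundamentalLatticeRep 2).N) (Fin (fundamentalLatticeRep 2).N) ℂ →ₗ[ℝ] ℝ, ∀ M,
        ℓ M = Λ (flat (fun e' => if e = e' then M * reb y e else 0)) := by
      intro e
      let F : Matrix (Fin (fundamentalLatticeRep 2).N) (Fin (fundamentalLatticeRep 2).N) ℂ → ℝ := fun M => Λ (flat (fun e' => if e = e' then M * reb y e else 0))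
      refine ⟨{ toFun := F, map_add' := ?_, map_smul' := ?_ }, fun M => rfl⟩
      · intro M M'
        dsimp only [F]
        have hA : (fun e' => if e = e' then (M + M') * reb y e else 0) =
            (fun e' => if e = e' then M * reb y e else 0) + (fun e' => if e = e' then M' * reb y e else 0) := by
          funext e'
          simp only [Pi.add_apply]
          split_ifs
          · rw [Matrix.add_mul]
          · rw [add_zero]
        rw [hA, flat_add, map_add]
      · intro a M
        dsimp only [F]
        have hA : (fun e' => if e = e' then (a • M) * reb y e else 0) =
            (a : ℂ) • (fun e' => if e = e' then M * reb y e else 0) := by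
          funext e'
          simp only [Pi.smul_apply]
          split_ifs
          · rw [← Complex.coe_smul, Matrix.smul_mul]
          · rw [smul_zero]
        rw [RingHom.id_apply, hA, flat_smul, map_smul]
    choose ℓ hℓ using hblk
    have hbr : ∀ n m : Edge 3 L × NoiseIdx (fundamentalLatticeRep 2).N, Λ (s m (s n y) - s n (s m y)) =
        if n.1 = m.1 then ℓ n.1 (((2 : ℝ) : ℂ) • (P m.2 * P n.2 - P n.2 * P m.2)) else 0 := by
      intro n m
      have hv : s m (s n y) - s n (s m y) = flat (reb (σ m (σ n y) - σ n (σ m y))) := by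
        rw [flat_reb, hs n y, hs m, hs m y, hs n]
      rw [hv, r_bracket]
      by_cases hnm : n.1 = m.1
      · have hA : (fun e => if n.1 = e ∧ m.1 = e then (((2 : ℝ) : ℂ) • (P m.2 * P n.2 - P n.2 * P m.2)) * reb y e else 0) =
            (fun e' => if n.1 = e' then (((2 : ℝ) : ℂ) • (P m.2 * P n.2 - P n.2 * P m.2)) * reb y n.1 else 0) := by
          funext e'
          by_cases he : n.1 = e'
          · rw [if_pos ⟨he, hnm ▸ he⟩, if_pos he, he]
          · rw [if_neg (fun h => he h.1), if_neg he]
        rw [if_pos hnm, hℓ, hA]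
      · rw [if_neg hnm]
        have h0 : (fun e => if n.1 = e ∧ m.1 = e then (((2 : ℝ) : ℂ) • (P m.2 * P n.2 - P n.2 * P m.2)) * reb y e else 0) =
            (0 : (Edge 3 L → Matrix (Fin (fundamentalLatticeRep 2).N) (Fin (fundamentalLatticeRep 2).N) ℂ)) := by
          funext e; rw [Pi.zero_apply, if_neg (fun h => hnm (h.1.trans h.2.symm))]
        rw [h0, flat_zero, map_zero]
    have hfld : ∀ n : Edge 3 L × NoiseIdx (fundamentalLatticeRep 2).N, Λ (s n y) = ℓ n.1 ((Real.sqrt 2 : ℂ) • P n.2) := by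
      intro n
      have hv : s n y = flat (reb (σ n y)) := by rw [flat_reb, hs n y]
      have hA : (fun e => if n.1 = e then (Real.sqrt 2 : ℂ) • (P n.2 * reb y e) else 0) =
          (fun e' => if n.1 = e' then ((Real.sqrt 2 : ℂ) • P n.2) * reb y n.1 else 0) := by
        funext e'
        by_cases he : n.1 = e'
        · rw [if_pos he, if_pos he, he, Matrix.smul_mul]
        · rw [if_neg he, if_neg he]
      rw [hv, r_σ, hℓ, hA]
    simp_rw [hbr, hfld]
    have hinner : ∀ (e : Edge 3 L) (ν : NoiseIdx (fundamentalLatticeRep 2).N),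
        ∑ e' : Edge 3 L, ∑ μ : NoiseIdx (fundamentalLatticeRep 2).N, (if e = e' then ℓ e (((2 : ℝ) : ℂ) • (P μ * P ν - P ν * P μ)) else 0) ^ 2 =
        4 * ∑ μ : NoiseIdx (fundamentalLatticeRep 2).N, (ℓ e (P μ * P ν - P ν * P μ)) ^ 2 := by
      intro e ν
      rw [Finset.sum_eq_single e]
      · simp only [if_true]
        rw [Finset.mul_sum]
        refine Finset.sum_congr rfl fun μ _ => ?_
        rw [Complex.coe_smul, map_smul, smul_eq_mul]
        ring
      · intro e' _ he'
        refine Finset.sum_eq_zero fun μ _ => ?_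
        rw [if_neg (Ne.symm he'), zero_pow two_ne_zero]
      · intro h; exact absurd (Finset.mem_univ e) h
    have hR : ∀ e : Edge 3 L, ∑ ν : NoiseIdx (fundamentalLatticeRep 2).N, 4 * ∑ μ : NoiseIdx (fundamentalLatticeRep 2).N, (ℓ e (P μ * P ν - P ν * P μ)) ^ 2 =
        16 * ∑ ν : NoiseIdx (fundamentalLatticeRep 2).N, (ℓ e (P ν)) ^ 2 := by
      intro e
      rw [← Finset.mul_sum, Finset.sum_comm]
      have h : ∑ μ : NoiseIdx (fundamentalLatticeRep 2).N, ∑ ν : NoiseIdx (fundamentalLatticeRep 2).N, (ℓ e (P μ * P ν - P ν * P μ)) ^ 2 =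
          4 * ∑ ν : NoiseIdx (fundamentalLatticeRep 2).N, (ℓ e (P ν)) ^ 2 := sum_sum_sq_apply_bracket_lieProj (ℓ e)
      rw [h]
      ring
    have hF : ∀ (e : Edge 3 L) (ν : NoiseIdx (fundamentalLatticeRep 2).N), (ℓ e ((Real.sqrt 2 : ℂ) • P ν)) ^ 2 = 2 * (ℓ e (P ν)) ^ 2 := by
      intro e ν
      rw [Complex.coe_smul, map_smul, smul_eq_mul, mul_pow, Real.sq_sqrt (by norm_num : (0:ℝ) ≤ 2)]
    have hL1 : ∑ n : Edge 3 L × NoiseIdx (fundamentalLatticeRep 2).N, ∑ m : Edge 3 L × NoiseIdx (fundamentalLatticeRep 2).N,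
        (if n.1 = m.1 then ℓ n.1 (((2 : ℝ) : ℂ) • (P m.2 * P n.2 - P n.2 * P m.2)) else 0) ^ 2 =
        ∑ e : Edge 3 L, ∑ ν : NoiseIdx (fundamentalLatticeRep 2).N, ∑ m : Edge 3 L × NoiseIdx (fundamentalLatticeRep 2).N,
          (if e = m.1 then ℓ e (((2 : ℝ) : ℂ) • (P m.2 * P ν - P ν * P m.2)) else 0) ^ 2 := Fintype.sum_prod_type _
    have hL2 : ∀ (e : Edge 3 L) (ν : NoiseIdx (fundamentalLatticeRep 2).N), ∑ m : Edge 3 L × NoiseIdx (fundamentalLatticeRep 2).N,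
          (if e = m.1 then ℓ e (((2 : ℝ) : ℂ) • (P m.2 * P ν - P ν * P m.2)) else 0) ^ 2 =
        ∑ e' : Edge 3 L, ∑ μ : NoiseIdx (fundamentalLatticeRep 2).N, (if e = e' then ℓ e (((2 : ℝ) : ℂ) • (P μ * P ν - P ν * P μ)) else 0) ^ 2 :=
      fun e ν => Fintype.sum_prod_type _
    have hRHS : ∑ n : Edge 3 L × NoiseIdx (fundamentalLatticeRep 2).N, (ℓ n.1 ((Real.sqrt 2 : ℂ) • P n.2)) ^ 2 =
        ∑ e : Edge 3 L, ∑ ν : NoiseIdx (fundamentalLatticeRep 2).N, (ℓ e ((Real.sqrt 2 : ℂ) • P ν)) ^ 2 := Fintype.sum_prod_type _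
    rw [hL1, hRHS]
    simp_rw [hL2, hinner, hR, hF]
    simp only [Finset.mul_sum]
    refine Finset.sum_congr rfl fun e _ => Finset.sum_congr rfl fun ν _ => ?_
    ring
  -- (5) Casimir sum
  have hCas : ∀ y : (Edge 3 L × Fin (fundamentalLatticeRep 2).N × Fin (fundamentalLatticeRep 2).N × Bool → ℝ), ∑ n, s n (s n y) = flat (fun e => ((2 : ℝ) : ℂ) • ((fundamentalLatticeRep 2).casimir * reb y e)) := by
    intro y
    refine r_inj _ _ (Eq.trans ?_ (r_flat (fun e => ((2 : ℝ) : ℂ) • ((fundamentalLatticeRep 2).casimir * reb y e))).symm)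
    rw [r_sum]
    have h1 : ∀ n : Edge 3 L × NoiseIdx (fundamentalLatticeRep 2).N, reb (s n (s n y)) = fun e => if n.1 = e ∧ n.1 = e then
        ((2 : ℝ) : ℂ) • (P n.2 * P n.2 * reb y e) else 0 := fun n => by rw [hs n y, hs n]; exact r_σσ n n y
    simp_rw [h1]
    funext e
    rw [Finset.sum_apply, Fintype.sum_prod_type, Finset.sum_eq_single e]
    · simp only [and_self, if_true]
      rw [LatticeRep.casimir, Finset.sum_mul, Finset.smul_sum]
    · intro e' _ he'
      exact Finset.sum_eq_zero fun ν _ => by rw [if_neg (fun h => he' h.1)]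
    · intro h; exact absurd (Finset.mem_univ _) h
  exact ⟨s, c, hs, hbracket, hanti, hRic, hCas⟩

end Summit.QuantumFields.YangMills.Theorems.ColdStartUniversality
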